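import Literature.AlgebraicGeometry.AbelianSchemes.DualPairFibreDimEq
import Literature.AlgebraicGeometry.AbelianSchemes.AbelianSchemeLiftRelDim
import HarnessLib

/-!
# Relative dimension is read on the fibres; the dual `Â → S` of an abelian scheme of relative dimension `g` has relative
# dimension `g` — unconditionally (GW I Thm. 6.28 ∕ Rem. 16.54; Mumford AV §13 Cor. 3; GW II Rem. 27.218 (1))

Layer `Literature/AlgebraicGeometry/AbelianSchemes`, namespace `Literature.AlgebraicGeometry.AbelianSchemes.AbelianSchemeOver`.
THEOREMS ONLY (no definition, no named fact, no instance, no notation, no `sorry`).  Cell `hodgecm-mathlib` (D-0151), P6 «MOD programme»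
(prover seat B-p02 (g22), capital «REL-DIM OF THE DUAL» after ★ `DualPairFibreDimEq`).

* §1 **`smoothOfRelativeDimension_of_forall_fibre`** — for a SMOOTH `q : X → S` whose fibre `X_s = X ×_S Spec κ(s) → Spec κ(s)` is smooth
  of relative dimension `g` at EVERY point `s ∈ S`, `q` is smooth of relative dimension `g`.  The closed-point argument of ★
  `AbelianSchemeLiftRelDim` over a general base: around `x ∈ X` Mathlib's `Smooth` gives a chart `V ∋ x` smooth of SOME relative dimension `d` (★
  `Motives.exists_opens_smoothOfRelativeDimension_of_smooth`); the open `f⁻¹V` of the fibre `X_{q x}` (`f : X_{q x} → X`) is a `κ(q x)`-scheme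
  smooth of relative dimension `d` (base change of the chart, Mathlib `isPullback_morphismRestrict`) AND `g` (an open of `X_{q x}`); it is
  non-empty (`x` lifts to the fibre, Mathlib `Scheme.Pullback.exists_preimage_pullback`), so at a closed point of it (★
  `Dimension.exists_mem_isClosed_singleton_of_mem_opens`) both numbers are `dim 𝒪` (★
  `Dimension.ringKrullDim_stalk_eq_of_smoothOfRelativeDimension_of_isClosed`, [GortzWedhorn2020] Lemma 6.26 ∕ Thm. 6.28), so `d = g`; glue by
  `IsZariskiLocalAtSource`;
* §2 **`isOfRelDim_iff_forall_dim_fibre`** — an abelian scheme `A → S` has relative dimension `g` iff `dim A_s = g` at every field-valued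
  point (`⇒` ★ `dim_fibre_of_isOfRelDim`; `⇐` §1 with ★ `isOfRelDim_dim_toAffine` at the residue fields); **`isOfRelDim_of_forall_dim_fibre`**;
* §3 **`DualPair.isOfRelDim_hat`** — for EVERY dual pair `D = (Â, 𝒫)` of an abelian scheme `A → S` of relative dimension `g`, **`Â → S` has
  relative dimension `g`** — §2 for `Â` with `dim Â_s = dim A_s = g` (★ `DualPair.hat_fibre_dim_eq`, [MumfordAV1970] §13 Cor. 3 at the
  fibres); ★ B-p04 `DualPair.isOfRelDim_hat_of_dualAbelianSchemeExists` WITHOUT the P-2′ «DUAL-S» letter, i.e. clause (ii)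
  «`dim(Xᵗ∕S) = dim(X∕S)`» of [GortzWedhorn2023] Rem. 27.218 (1) for the interface dual pair; **`DualPair.isOfRelDim_hat_iff`** (`Â` and `A`
  have the same relative dimensions); **`DualPair.isOfRelDim_of_isOfRelDim_hat`**.

HC_CM is proved only modulo the printed citations (2 remaining named inputs hLiu418, h413) until rung 0 closes; this file asserts nothing about HC
and is count-neutral ★ capital.

## References
* [GortzWedhorn2020] U. Görtz, T. Wedhorn, *Algebraic Geometry I*, 2nd ed. (2020), Lemma 6.26 and Thm. 6.28 (relative dimension at closed
  points), Remark 16.54 (p. 539), Prop. 3.35 (closed points very dense).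
* [MumfordAV1970] D. Mumford, *Abelian Varieties* (1970), §13 Cor. 3 (p. 130).
* [GortzWedhorn2023] U. Görtz, T. Wedhorn, *Algebraic Geometry II* (2023), Remark 27.218 (1) (p. 689), Thm. 27.198 (2) (pp. 679–680).
* [MilneAV2008] J. S. Milne, *Abelian Varieties* (v2.0, 2008), I §8 pp. 36–37 (Rem. 8.8).
-/

set_option autoImplicit false

noncomputable section

-- `TopCat.Presheaf`/`Scheme.Modules` and the `Over`/`Scheme` wrappers are not reducible (as in ★ `DualPairDimEq`).
set_option backward.isDefEq.respectTransparency false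

universe u

open CategoryTheory CategoryTheory.Limits AlgebraicGeometry TopologicalSpace IsLocalRing

namespace Literature.AlgebraicGeometry.AbelianSchemes

namespace AbelianSchemeOver

open Literature.AlgebraicGeometry.Motives

/-! ## §1 Relative dimension of a smooth morphism is read on the fibres -/

/-- **A smooth morphism all of whose fibres are smooth of relative dimension `g` is smooth of relative dimension `g`**: `q : X → S`
smooth and, for every `s ∈ S`, `X ×_S Spec κ(s) → Spec κ(s)` smooth of relative dimension `g` ⇒ `q` smooth of relative dimension `g`
(the relative dimension of a smooth morphism at `x` is `dim_x` of the fibre, [GortzWedhorn2020] Thm. 6.28 ∕ Remark 16.54; proof: the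
closed-point argument of ★ `smoothOfRelativeDimension_of_isPullback_specMap_mk` over a general base).
[cite: GortzWedhorn2020, Lemma 6.26 and Thm. 6.28] [cite: GortzWedhorn2020, Remark 16.54 (p. 539)] -/
theorem smoothOfRelativeDimension_of_forall_fibre {X S : Scheme.{u}} (q : X ⟶ S) [Smooth q] (g : ℕ)
    (h : ∀ s : S, SmoothOfRelativeDimension g (pullback.snd q (S.fromSpecResidueField s))) :
    SmoothOfRelativeDimension g q := by
  -- local relative dimensions of `q` all equal `g`
  have key : ∀ x : X, ∃ V : X.Opens, x ∈ V ∧ SmoothOfRelativeDimension g (V.ι ≫ q) := by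
    intro x
    obtain ⟨V, d, hxV, hd⟩ := Literature.AlgebraicGeometry.Motives.exists_opens_smoothOfRelativeDimension_of_smooth q x
    -- the fibre through `q x`
    let ι := S.fromSpecResidueField (q.base x)
    let qk : pullback q ι ⟶ Spec (S.residueField (q.base x)) := pullback.snd q ι
    let f : pullback q ι ⟶ X := pullback.fst q ι
    have Hsq : IsPullback f qk q ι := IsPullback.of_hasPullback q ι
    haveI hg : SmoothOfRelativeDimension g qk := h (q.base x)
    haveI : Smooth qk := SmoothOfRelativeDimension.smooth g qk
    -- the open `f⁻¹V` of the fibre, over `κ(q x)`: smooth of relative dimension `d` …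
    have Sq : IsPullback (f ∣_ V) ((f ⁻¹ᵁ V).ι ≫ qk) (V.ι ≫ q) ι := (isPullback_morphismRestrict f V).paste_vert Hsq
    haveI hd' : SmoothOfRelativeDimension d ((f ⁻¹ᵁ V).ι ≫ qk) := by
      haveI := smoothOfRelativeDimension_isStableUnderBaseChange (n := d)
      haveI := hd
      exact MorphismProperty.of_isPullback (P := @SmoothOfRelativeDimension d) Sq hd
    -- … and of relative dimension `g`
    have hg' : SmoothOfRelativeDimension g ((f ⁻¹ᵁ V).ι ≫ qk) := by
      have h0 := (inferInstance : SmoothOfRelativeDimension (0 + g) ((f ⁻¹ᵁ V).ι ≫ qk))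
      rwa [Nat.zero_add] at h0
    -- `x` lifts to the fibre: a point `w` of `X ×_S Spec κ(q x)` over `x` and the closed point
    obtain ⟨w, hw, -⟩ := Scheme.Pullback.exists_preimage_pullback (f := q) (g := ι) x
      (closedPoint (S.residueField (q.base x))) (by rw [Scheme.fromSpecResidueField_apply])
    have hwV : w ∈ f ⁻¹ᵁ V := by show f.base w ∈ V; rw [hw]; exact hxV
    -- a closed point of `f⁻¹V` (Jacobson), where both relative dimensions are `dim 𝒪`
    haveI : LocallyOfFiniteType ((f ⁻¹ᵁ V).ι ≫ qk) := inferInstance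
    obtain ⟨w', -, hw'⟩ := Literature.AlgebraicGeometry.Dimension.exists_mem_isClosed_singleton_of_mem_opens
      ((f ⁻¹ᵁ V).ι ≫ qk) (U := ⊤) (x := (⟨w, hwV⟩ : ↥(f ⁻¹ᵁ V))) trivial
    have h1 := Literature.AlgebraicGeometry.Dimension.ringKrullDim_stalk_eq_of_smoothOfRelativeDimension_of_isClosed
      ((f ⁻¹ᵁ V).ι ≫ qk) d hw'
    have h2 := @Literature.AlgebraicGeometry.Dimension.ringKrullDim_stalk_eq_of_smoothOfRelativeDimension_of_isClosed
      _ _ _ ((f ⁻¹ᵁ V).ι ≫ qk) g hg' _ hw'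
    rw [h1] at h2
    have hdg : d = g := by exact_mod_cast h2
    exact ⟨V, hxV, hdg ▸ hd⟩
  choose V hxV hV using key
  have htop : ⨆ x, V x = ⊤ := top_le_iff.mp fun x _ => Opens.mem_iSup.mpr ⟨x, hxV x⟩
  rw [IsZariskiLocalAtSource.iff_of_iSup_eq_top (P := @SmoothOfRelativeDimension g) V htop]
  exact hV

/-! ## §2 Abelian schemes: relative dimension `g` iff all fibres have dimension `g` -/

section AnyBase

variable {S : Scheme.{u}}

/-- **An abelian scheme whose fibres all have dimension `g` has relative dimension `g`**: `A → S` is smooth (an abelian scheme), and at the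
residue field of every `s ∈ S` the fibre `A_s → Spec κ(s)` has relative dimension `dim A_s` (★ `isOfRelDim_dim_toAffine`) `= g`; §1.
[cite: GortzWedhorn2020, Remark 16.54 (p. 539)] [cite: GortzWedhorn2020, Lemma 6.26 and Thm. 6.28] -/
theorem isOfRelDim_of_forall_dim_fibre (A : AbelianSchemeOver S) {g : ℕ}
    (h : ∀ (K : Type u) [Field K] (s : Spec (.of K) ⟶ S), (A.fibre s).toAbelianVariety.dim = g) : A.IsOfRelDim g := by
  rw [isOfRelDim_iff]
  haveI := A.isSmooth
  refine smoothOfRelativeDimension_of_forall_fibre A.X.hom g fun s => ?_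
  have h1 : (A.baseChange (S.fromSpecResidueField s)).IsOfRelDim (A.fibre (S.fromSpecResidueField s)).toAbelianVariety.dim :=
    isOfRelDim_dim_toAffine _
  rw [h _ (S.fromSpecResidueField s)] at h1
  exact h1

/-- **Relative dimension `g` iff every fibre has dimension `g`** for an abelian scheme over any base (`⇒` ★ `dim_fibre_of_isOfRelDim`; `⇐`
`isOfRelDim_of_forall_dim_fibre`). [cite: GortzWedhorn2020, Remark 16.54 (p. 539)] -/
theorem isOfRelDim_iff_forall_dim_fibre (A : AbelianSchemeOver S) (g : ℕ) :
    A.IsOfRelDim g ↔ ∀ (K : Type u) [Field K] (s : Spec (.of K) ⟶ S), (A.fibre s).toAbelianVariety.dim = g :=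
  ⟨fun hA _ _ s => dim_fibre_of_isOfRelDim hA s, isOfRelDim_of_forall_dim_fibre A⟩

/-! ## §3 The dual has the relative dimension of `A` -/

/-- **THE DUAL OF AN ABELIAN SCHEME OF RELATIVE DIMENSION `g` HAS RELATIVE DIMENSION `g`** — for EVERY dual pair `D = (Â, 𝒫)` ([MilneAV2008]
I §8) of `A → S`, with no dual-existence, polarization, connectedness or characteristic hypothesis: `dim Â_s = dim A_s = g` at every field
point (★ `DualPair.hat_fibre_dim_eq`, [MumfordAV1970] §13 Cor. 3; ★ `dim_fibre_of_isOfRelDim`) and §2 for `Â`.  Clause (ii)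
«`dim(Xᵗ∕S) = dim(X∕S)`» of [GortzWedhorn2023] Rem. 27.218 (1) for the tree's interface dual pair; ★ `DualPair.isOfRelDim_hat_of_dualAbelianSchemeExists`
without the P-2′ letter. [cite: MumfordAV1970, §13 Cor. 3 (p. 130)] [cite: GortzWedhorn2023, Remark 27.218 (1) (p. 689)]
[cite: GortzWedhorn2020, Remark 16.54 (p. 539)] -/
theorem DualPair.isOfRelDim_hat {A : AbelianSchemeOver S} (D : A.DualPair) {g : ℕ} (hA : A.IsOfRelDim g) : D.hat.IsOfRelDim g :=
  isOfRelDim_of_forall_dim_fibre D.hat fun _ _ s => (DualPair.hat_fibre_dim_eq D s).trans (dim_fibre_of_isOfRelDim hA s)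

/-- Conversely, `A` has the relative dimension of its dual. [cite: MumfordAV1970, §13 Cor. 3 (p. 130)] [cite: GortzWedhorn2020, Remark 16.54 (p. 539)] -/
theorem DualPair.isOfRelDim_of_isOfRelDim_hat {A : AbelianSchemeOver S} (D : A.DualPair) {g : ℕ} (hD : D.hat.IsOfRelDim g) :
    A.IsOfRelDim g :=
  isOfRelDim_of_forall_dim_fibre A fun _ _ s => (DualPair.dim_fibre_eq_dim_hat_fibre D s).trans (dim_fibre_of_isOfRelDim hD s)

/-- **`Â` and `A` have the same relative dimensions.** [cite: MumfordAV1970, §13 Cor. 3 (p. 130)] [cite: GortzWedhorn2023, Remark 27.218 (1) (p. 689)] -/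
theorem DualPair.isOfRelDim_hat_iff {A : AbelianSchemeOver S} (D : A.DualPair) (g : ℕ) : D.hat.IsOfRelDim g ↔ A.IsOfRelDim g :=
  ⟨DualPair.isOfRelDim_of_isOfRelDim_hat D, DualPair.isOfRelDim_hat D⟩

end AnyBase

end AbelianSchemeOver

end Literature.AlgebraicGeometry.AbelianSchemes

end
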